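import Mathlib
import Literature.NumberTheory.Automorphic.TwistedQuotientConeDescentStep
import Summits.Langlands.Langlands.Theorems.IrreducibilityBySelfDualityHeckeEigenvalueFieldStubConeOpGrowth
import Summits.Langlands.Langlands.Theorems.IrreducibilityBySelfDualityHeckeEigenvalueFieldDescentTower
import Summits.Langlands.Langlands.Theorems.IrreducibilityBySelfDualityHeckeEigenvalueFieldStubStairBottom
import HarnessLib

/-!
# The staircase has polynomial `C¹` growth — crux HeckeEigenvalueField (stmt-Langlands-13632),
# line Sketch, stub `stub_stair_growth` (GROWTH-κ)

Setting of `Literature.NumberTheory.Automorphic.TwistedQuotientConeDescent`: a linear action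
`a : Γ →* (W →L[ℝ] W)` preserving an open convex `X ⊆ W`, a base point `x₀ ∈ X`, a family `om c` of
`(q+1)`-forms placed in degree `q + 1` (`TwistedQuotient.single`), and the STAIRCASE
`κ⁽ᵖ⁾ = TwistedQuotient.stair p` (radial primitives `K_y` of `Literature.Geometry.Kaehler.PoincareLemmaFlat`
centred at the last vertex `y = a(g_p) x₀`, alternating face sums).

Statement.  Let `sz ≥ 1` be a size function on `X` dominating the norm (`‖x‖ ≤ C₀ sz x`) and
polynomial along segments (`sz ((1-t) x + t y) ≤ C (sz x · sz y)^k`).  If every `om c` is `C^∞` on `X`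
with `‖om c x‖, ‖D(om c) x‖ ≤ C sz(x)^k`, then every component `κ⁽ᵖ⁾(g) c r` and its derivative are
bounded by `C' sz(x)^{k'}` on `X`.

Proof.
* `StairGrowth.coneOperator_growth` — **the radial homotopy operator does not lose polynomial
  growth**: for `β` of class `C^∞` on `X` with `‖β‖, ‖Dβ‖ ≤ C sz^k` on `X` and a centre `y ∈ X`, the
  segment `[y, x]` lies in `X` (convexity) where `sz ≤ C_seg (sz y · sz x)^{k_seg}` — a polynomial in
  `sz x` for the fixed centre —, so the landed stub `stub_norm_coneOperator_le` (GROWTH-K: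
  `‖K_y β (x)‖ ≤ B ‖x - y‖`, `‖D(K_y β)(x)‖ ≤ B' ‖x - y‖ + B` for bounds `B, B'` of `β, Dβ` along the
  segment) and `‖x - y‖ ≤ ‖x‖ + ‖y‖ ≤ (C₀ + ‖y‖) sz x` give polynomial `C¹` bounds for `K_y β`.
* Induction on `p`: `κ⁽⁰⁾(g₀) c r = K_{a(g₀)x₀} (single om c (r+1))` (the form `om c` or `0`), and ON
  THE NOSE `κ⁽ᵖ⁺¹⁾(g₀, …, g_{p+1}) c r = (-1)^{p+1} K_{a(g_{p+1})x₀} (κ⁽ᵖ⁾(g₀, …, g_p) c (r+1))`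
  (`StairBottom.stair_succ_eq_last`: the faces through the last vertex are radial primitives centred
  there and are killed by `K_y ∘ K_y = 0`); the intermediate forms are `C^∞` on `X`
  (`smoothOn_stair`), the centres `a(γ) x₀` lie in `X`, and a sign does not change norms.

## References

* R. Bott, L. W. Tu, *Differential Forms in Algebraic Topology*, GTM 82 (1982), §I.4 (the homotopy
  operator), §II.9 (the staircase). [BottTu1982Forms]
* A. Borel, *Regularization theorems in Lie algebra cohomology. Applications*, Duke Math. J. 50
  (1983), §3. [Borel1983Regularization]
-/

set_option linter.dupNamespace false -- project-wide: `Summit.Langlands.Langlands` is the mandated namespace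

noncomputable section

open Filter Topology Set Literature.Geometry.Kaehler Literature.NumberTheory.Automorphic
  Literature.NumberTheory.Automorphic.TwistedQuotient
open scoped ContDiff Topology

namespace Summit.Langlands.Langlands.Theorems.HeckeEigenvalueField.Res

namespace StairGrowth

/-- **The radial homotopy operator does not lose polynomial growth.**  On an open convex `X` with a
size function `sz ≥ 1` dominating the norm and polynomial along segments, if `β` is `C^∞` on `X` with
`‖β‖, ‖Dβ‖ ≤ C sz^k` on `X`, then for every centre `y ∈ X` the radial primitive `K_y β` satisfies
`‖K_y β‖, ‖D(K_y β)‖ ≤ C' sz^{k'}` on `X` (the segment `[y, x] ⊆ X` carries the bound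
`C (C_seg (sz y · sz x)^{k_seg})^k`, and `‖x - y‖ ≤ (C₀ + ‖y‖) sz x`; then `stub_norm_coneOperator_le`).
[cite: BottTu1982Forms, §I.4] -/
theorem coneOperator_growth
    {E : Type*} [NormedAddCommGroup E] [NormedSpace ℝ E] [FiniteDimensional ℝ E]
    {F : Type*} [NormedAddCommGroup F] [NormedSpace ℝ F] [CompleteSpace F]
    {X : Set E} (hXo : IsOpen X) (hXc : Convex ℝ X) {y : E} (hy : y ∈ X)
    (sz : E → ℝ) (hsz : ∀ x ∈ X, 1 ≤ sz x) (hszn : ∃ C₀ : ℝ, ∀ x ∈ X, ‖x‖ ≤ C₀ * sz x)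
    (hseg : ∃ (C : ℝ) (k : ℕ), ∀ x ∈ X, ∀ y ∈ X, ∀ t ∈ Set.Icc (0 : ℝ) 1,
      sz ((1 - t) • x + t • y) ≤ C * (sz x * sz y) ^ k)
    {n : ℕ} {β : E → E [⋀^Fin (n + 1)]→L[ℝ] F} (hβ : ContDiffOn ℝ ∞ β X)
    (hb : ∃ (C : ℝ) (k : ℕ), ∀ x ∈ X, ‖β x‖ ≤ C * sz x ^ k ∧ ‖fderiv ℝ β x‖ ≤ C * sz x ^ k) :
    ∃ (C : ℝ) (k : ℕ), ∀ x ∈ X, ‖coneOperator y β x‖ ≤ C * sz x ^ k ∧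
      ‖fderiv ℝ (coneOperator y β) x‖ ≤ C * sz x ^ k := by
  obtain ⟨C₀, hC₀⟩ := hszn
  obtain ⟨Cs, ks, hCs⟩ := hseg
  obtain ⟨C, k, hC⟩ := hb
  have hsy : 1 ≤ sz y := hsz y hy
  -- the constants: `A sz(x)^m` bounds `β`, `Dβ` along `[y, x]`; `D sz(x)` bounds `‖x - y‖`
  set A : ℝ := max C 0 * (max Cs 0 * sz y ^ ks) ^ k with hA
  set D : ℝ := max C₀ 0 + ‖y‖ with hD
  have hA0 : 0 ≤ A := by positivity
  have hD0 : 0 ≤ D := by positivity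
  refine ⟨A * (D + 1), ks * k + 1, fun x hx => ?_⟩
  have hsx : 1 ≤ sz x := hsz x hx
  have hsx0 : 0 ≤ sz x := zero_le_one.trans hsx
  -- the segment `[y, x]` lies in `X`, where `sz ≤ Cs₁ (sz y sz x)^ks`
  have hseg' : ∀ t ∈ Icc (0 : ℝ) 1, y + t • (x - y) ∈ X ∧
      sz (y + t • (x - y)) ≤ max Cs 0 * (sz y * sz x) ^ ks := by
    intro t ht
    have he : y + t • (x - y) = (1 - t) • y + t • x := by
      rw [sub_smul, one_smul, smul_sub]; abel
    refine ⟨hXc.add_smul_sub_mem hy hx ht, ?_⟩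
    rw [he]
    calc sz ((1 - t) • y + t • x) ≤ Cs * (sz y * sz x) ^ ks := hCs y hy x hx t ht
      _ ≤ max Cs 0 * (sz y * sz x) ^ ks := by gcongr; exact le_max_left _ _
  -- hence `‖β‖, ‖Dβ‖ ≤ A sz(x)^(ks k)` along the segment
  have hpoly : ∀ t ∈ Icc (0 : ℝ) 1, C * sz (y + t • (x - y)) ^ k ≤ A * sz x ^ (ks * k) := by
    intro t ht
    obtain ⟨hmem, hle⟩ := hseg' t ht
    have h0 : 0 ≤ sz (y + t • (x - y)) := zero_le_one.trans (hsz _ hmem)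
    calc C * sz (y + t • (x - y)) ^ k ≤ max C 0 * sz (y + t • (x - y)) ^ k :=
          mul_le_mul_of_nonneg_right (le_max_left _ _) (pow_nonneg h0 k)
      _ ≤ max C 0 * (max Cs 0 * (sz y * sz x) ^ ks) ^ k :=
          mul_le_mul_of_nonneg_left (pow_le_pow_left₀ h0 hle k) (le_max_right _ _)
      _ = A * sz x ^ (ks * k) := by rw [hA]; ring
  have hB : ∀ t ∈ Icc (0 : ℝ) 1, ‖β (y + t • (x - y))‖ ≤ A * sz x ^ (ks * k) := fun t ht =>
    ((hC _ (hseg' t ht).1).1).trans (hpoly t ht)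
  have hB' : ∀ t ∈ Icc (0 : ℝ) 1, ‖fderiv ℝ β (y + t • (x - y))‖ ≤ A * sz x ^ (ks * k) :=
    fun t ht => ((hC _ (hseg' t ht).1).2).trans (hpoly t ht)
  obtain ⟨hK, hDK⟩ := stub_norm_coneOperator_le hXo (hXc.starConvex hy) hβ hx hB hB'
  -- `‖x - y‖ ≤ D sz(x)`
  have hxy : ‖x - y‖ ≤ D * sz x := by
    calc ‖x - y‖ ≤ ‖x‖ + ‖y‖ := norm_sub_le x y
      _ ≤ C₀ * sz x + ‖y‖ * 1 := by rw [mul_one]; exact add_le_add (hC₀ x hx) le_rfl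
      _ ≤ max C₀ 0 * sz x + ‖y‖ * sz x :=
          add_le_add (mul_le_mul_of_nonneg_right (le_max_left _ _) hsx0)
            (mul_le_mul_of_nonneg_left hsx (norm_nonneg _))
      _ = D * sz x := by rw [hD]; ring
  have hpow : sz x ^ (ks * k) ≤ sz x ^ (ks * k + 1) := pow_le_pow_right₀ hsx (Nat.le_succ _)
  have hAs : 0 ≤ A * sz x ^ (ks * k) := mul_nonneg hA0 (pow_nonneg hsx0 _)
  have hmain : A * sz x ^ (ks * k) * ‖x - y‖ ≤ A * D * sz x ^ (ks * k + 1) := by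
    calc A * sz x ^ (ks * k) * ‖x - y‖ ≤ A * sz x ^ (ks * k) * (D * sz x) :=
          mul_le_mul_of_nonneg_left hxy hAs
      _ = A * D * sz x ^ (ks * k + 1) := by ring
  constructor
  · calc ‖coneOperator y β x‖ ≤ A * sz x ^ (ks * k) * ‖x - y‖ := hK
      _ ≤ A * D * sz x ^ (ks * k + 1) := hmain
      _ ≤ A * (D + 1) * sz x ^ (ks * k + 1) :=
          mul_le_mul_of_nonneg_right (mul_le_mul_of_nonneg_left
            (le_add_of_nonneg_right zero_le_one) hA0) (pow_nonneg hsx0 _)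
  · calc ‖fderiv ℝ (coneOperator y β) x‖
          ≤ A * sz x ^ (ks * k) * ‖x - y‖ + A * sz x ^ (ks * k) := hDK
      _ ≤ A * D * sz x ^ (ks * k + 1) + A * sz x ^ (ks * k + 1) :=
          add_le_add hmain (mul_le_mul_of_nonneg_left hpow hA0)
      _ = A * (D + 1) * sz x ^ (ks * k + 1) := by ring

variable {Γ 𝒢 : Type} [Group Γ] [Group 𝒢] (L : Subgroup 𝒢)
  {V : Type} [NormedAddCommGroup V] [NormedSpace ℂ V] [CompleteSpace V]
  {W : Type} [NormedAddCommGroup W] [NormedSpace ℝ W] [FiniteDimensional ℝ W]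
  (a : Γ →* (W →L[ℝ] W))

omit [CompleteSpace V] [FiniteDimensional ℝ W] in
/-- Every degree of `single om` is `C^∞` on `X` when `om` is (it is `om c` or `0`). [folklore] -/
theorem contDiffOn_single {X : Set W} {q : ℕ} (om : (𝒢 ⧸ L) → W → W [⋀^Fin (q + 1)]→L[ℝ] V)
    (hωs : ∀ c : 𝒢 ⧸ L, ContDiffOn ℝ ∞ (om c) X) (c : 𝒢 ⧸ L) (r : ℕ) :
    ContDiffOn ℝ ∞ (single L om c r) X := by
  by_cases h : r = q + 1
  · subst h
    rw [single_self]
    exact hωs c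
  · rw [single_of_ne L om c h]
    exact contDiffOn_const

omit [CompleteSpace V] [FiniteDimensional ℝ W] in
/-- Every degree of `single om` inherits the polynomial `C¹` bounds of `om` (it is `om c` or `0`).
[folklore] -/
theorem growth_single {X : Set W} (sz : W → ℝ) {q : ℕ}
    (om : (𝒢 ⧸ L) → W → W [⋀^Fin (q + 1)]→L[ℝ] V)
    (hωb : ∀ c : 𝒢 ⧸ L, ∃ (C : ℝ) (k : ℕ), ∀ x ∈ X,
      ‖om c x‖ ≤ C * sz x ^ k ∧ ‖fderiv ℝ (om c) x‖ ≤ C * sz x ^ k) (c : 𝒢 ⧸ L) (r : ℕ) :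
    ∃ (C : ℝ) (k : ℕ), ∀ x ∈ X,
      ‖single L om c r x‖ ≤ C * sz x ^ k ∧ ‖fderiv ℝ (single L om c r) x‖ ≤ C * sz x ^ k := by
  by_cases h : r = q + 1
  · subst h
    rw [single_self]
    exact hωb c
  · refine ⟨0, 0, fun x _ => ?_⟩
    rw [single_of_ne L om c h, fderiv_zero]
    simp only [Pi.zero_apply, norm_zero, ContinuousLinearMap.opNorm_zero, zero_mul, le_refl,
      and_self]

/-- **Polynomial `C¹` growth of the staircase**, all levels `p`, all simplices `g` and all degrees `r`
at once (induction on `p` along `StairBottom.stair_succ_eq_last`, each step by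
`coneOperator_growth`). [cite: BottTu1982Forms, §I.4 and §II.9] -/
theorem stair_growth {X : Set W} (hXo : IsOpen X) (hXc : Convex ℝ X)
    (hmaps : ∀ γ : Γ, Set.MapsTo (a γ) X X) {x₀ : W} (hx₀ : x₀ ∈ X)
    (sz : W → ℝ) (hsz : ∀ x ∈ X, 1 ≤ sz x) (hszn : ∃ C₀ : ℝ, ∀ x ∈ X, ‖x‖ ≤ C₀ * sz x)
    (hseg : ∃ (C : ℝ) (k : ℕ), ∀ x ∈ X, ∀ y ∈ X, ∀ t ∈ Set.Icc (0 : ℝ) 1,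
      sz ((1 - t) • x + t • y) ≤ C * (sz x * sz y) ^ k)
    {q : ℕ} (om : (𝒢 ⧸ L) → W → W [⋀^Fin (q + 1)]→L[ℝ] V)
    (hωs : ∀ c : 𝒢 ⧸ L, ContDiffOn ℝ ∞ (om c) X)
    (hωb : ∀ c : 𝒢 ⧸ L, ∃ (C : ℝ) (k : ℕ), ∀ x ∈ X,
      ‖om c x‖ ≤ C * sz x ^ k ∧ ‖fderiv ℝ (om c) x‖ ≤ C * sz x ^ k) (c : 𝒢 ⧸ L) :
    ∀ (p : ℕ) (g : Fin (p + 1) → Γ) (r : ℕ), ∃ (C : ℝ) (k : ℕ), ∀ x ∈ X,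
      ‖stair L a (single L om) x₀ p g c r x‖ ≤ C * sz x ^ k ∧
        ‖fderiv ℝ (stair L a (single L om) x₀ p g c r) x‖ ≤ C * sz x ^ k := by
  have hωs' : ∀ (c : 𝒢 ⧸ L) (r : ℕ), ContDiffOn ℝ ∞ (single L om c r) X :=
    contDiffOn_single L om hωs
  have hsm := smoothOn_stair L a hXo hXc hmaps hx₀ (single L om) hωs'
  intro p
  induction p with
  | zero =>
    intro g r
    have e : stair L a (single L om) x₀ 0 g c r =
        coneOperator (a (g (Fin.last 0)) x₀) (single L om c (r + 1)) := rfl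
    rw [e]
    exact coneOperator_growth hXo hXc (hmaps _ hx₀) sz hsz hszn hseg (hωs' c (r + 1))
      (growth_single L sz om hωb c (r + 1))
  | succ p ih =>
    intro g r
    rw [StairBottom.stair_succ_eq_last]
    have hβ : ContDiffOn ℝ ∞ (stair L a (single L om) x₀ p (fun i => g (Fin.castSucc i)) c (r + 1)) X :=
      hsm p _ c (r + 1)
    obtain ⟨C, k, hCk⟩ := coneOperator_growth hXo hXc (hmaps (g (Fin.last (p + 1))) hx₀) sz hsz
      hszn hseg hβ (ih _ (r + 1))
    refine ⟨C, k, fun x hx => ?_⟩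
    obtain ⟨h1, h2⟩ := hCk x hx
    have hu : ‖(-1 : ℝ) ^ (p + 1)‖ = 1 := by simp
    have hdiff : DifferentiableAt ℝ (coneOperator (a (g (Fin.last (p + 1))) x₀)
        (stair L a (single L om) x₀ p (fun i => g (Fin.castSucc i)) c (r + 1))) x :=
      ((contDiffOn_coneOperator hXo (hXc.starConvex (hmaps _ hx₀)) hβ).contDiffAt
        (hXo.mem_nhds hx)).differentiableAt (by simp)
    constructor
    · rw [Pi.smul_apply, norm_smul, hu, one_mul]
      exact h1
    · -- `‖(-1)^{p+1} • T‖ ≤ ‖T‖` through the operator norm (pointwise `‖(-1)^{p+1} • T v‖ = ‖T v‖`)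
      rw [fderiv_const_smul hdiff]
      set T := fderiv ℝ (coneOperator (a (g (Fin.last (p + 1))) x₀)
        (stair L a (single L om) x₀ p (fun i => g (Fin.castSucc i)) c (r + 1))) x with hT
      have hle : ‖((-1 : ℝ) ^ (p + 1)) • T‖ ≤ ‖T‖ :=
        ContinuousLinearMap.opNorm_le_bound _ (ContinuousLinearMap.opNorm_nonneg T) fun v => by
          rw [_root_.smul_apply, norm_smul, hu, one_mul]
          exact T.le_opNorm v
      exact hle.trans h2

end StairGrowth

/-- **Stub GROWTH-κ — the staircase has polynomial `C¹` growth.**  If the closed family `ω` is smooth on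
the convex open `X` with `C¹` bounds polynomial in a size function `sz ≥ 1` which is polynomial along
segments and dominates the norm, then every component `κ⁽ᵖ⁾(g)` of the staircase
(`TwistedQuotient.stair`: radial primitives centred at the vertices `a(g_last) x₀`, alternating sums) has
polynomial `C¹` bounds on `X` (the homotopy operator does not lose growth: `stub_norm_coneOperator_le`).
Proof: `StairGrowth.stair_growth` (induction on `p` along the closed recursion
`κ⁽ᵖ⁺¹⁾(g) = (-1)^{p+1} K_{a(g_{p+1})x₀} κ⁽ᵖ⁾(g₀, …, g_p)`, `StairBottom.stair_succ_eq_last`, each step by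
`StairGrowth.coneOperator_growth`).  The smoothness exponent `((⊤ : ℕ∞) : WithTop ℕ∞)` is `∞` (`C^∞`).
[cite: BottTu1982Forms, §I.4] [cite: Borel1983Regularization, §3] -/
theorem stub_stair_growth
    {Γ 𝒢 : Type} [Group Γ] [Group 𝒢] (L : Subgroup 𝒢)
    {V : Type} [NormedAddCommGroup V] [NormedSpace ℂ V] [CompleteSpace V]
    {W : Type} [NormedAddCommGroup W] [NormedSpace ℝ W] [FiniteDimensional ℝ W]
    (a : Γ →* (W →L[ℝ] W)) {X : Set W} (hXo : IsOpen X) (hXc : Convex ℝ X)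
    (hmaps : ∀ γ : Γ, Set.MapsTo (a γ) X X) {x₀ : W} (hx₀ : x₀ ∈ X)
    (sz : W → ℝ) (hsz : ∀ x ∈ X, 1 ≤ sz x) (hszn : ∃ C₀ : ℝ, ∀ x ∈ X, ‖x‖ ≤ C₀ * sz x)
    (hseg : ∃ (C : ℝ) (k : ℕ), ∀ x ∈ X, ∀ y ∈ X, ∀ t ∈ Set.Icc (0 : ℝ) 1,
      sz ((1 - t) • x + t • y) ≤ C * (sz x * sz y) ^ k)
    {q : ℕ} (om : (𝒢 ⧸ L) → W → W [⋀^Fin (q + 1)]→L[ℝ] V)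
    (hωs : ∀ c : 𝒢 ⧸ L, ContDiffOn ℝ ((⊤ : ℕ∞) : WithTop ℕ∞) (om c) X)
    (hωb : ∀ c : 𝒢 ⧸ L, ∃ (C : ℝ) (k : ℕ), ∀ x ∈ X,
      ‖om c x‖ ≤ C * sz x ^ k ∧ ‖fderiv ℝ (om c) x‖ ≤ C * sz x ^ k)
    (p : ℕ) (g : Fin (p + 1) → Γ) (c : 𝒢 ⧸ L) (r : ℕ) :
    ∃ (C : ℝ) (k : ℕ), ∀ x ∈ X,
      ‖TwistedQuotient.stair L a (TwistedQuotient.single L om) x₀ p g c r x‖ ≤ C * sz x ^ k ∧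
        ‖fderiv ℝ (TwistedQuotient.stair L a (TwistedQuotient.single L om) x₀ p g c r) x‖ ≤
          C * sz x ^ k := by
  exact StairGrowth.stair_growth L a hXo hXc hmaps hx₀ sz hsz hszn hseg om hωs hωb c p g r

end Summit.Langlands.Langlands.Theorems.HeckeEigenvalueField.Res

end
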